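/-
Copyright (c) 2026 the pub-hodgecm-mathlib formalisation cell (harness21).  Prover seat hodgecm-mathlib-K2Liu-p09 (g0): Track B «K2-LIT»,
#184♮ = hLiu418 = stmt-HodgeConjecture-24832, file #9 of the K2_Liu road, organ (III-b) step E5′ (B2: compact fundamental set for `N_Δ(L⁺)\N_Δ(𝔸)`); 2026-09-04.
-/
import Summits.HodgeConjecture.HodgeConjecture.Theorems.K2LiuSiegelDoubledUnipotentChart    -- ★ B3a `υ`, `skew_proj`, …
import Summits.HodgeConjecture.HodgeConjecture.Theorems.K2LiuSiegelDoubledRationalPoints    -- ★ B1c `mem_ratH_of_blk_eq_unip_map`, `map_cstar`, …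
import Literature.NumberTheory.Automorphic.AdelicFundamentalDomain                          -- ★ Tate's fundamental domain `D ⊆ 𝔸_L`
import HarnessLib

/-!
# Crux `HLiu418`, Track B road `K2_Liu`, unit U3a «SIEGEL EISENSTEIN SERIES», file #9 — helper 19 (organ (III-b), step E5′, part B2):
# A COMPACT FUNDAMENTAL SET for `N_Δ(L⁺) \ N_Δ(𝔸)` (the unipotent radical of the Siegel parabolic is cocompact modulo its rational points)

Cell `hodgecm-mathlib`, crux item hLiu418 = `stmt-HodgeConjecture-24832`; squad K2 ∕ K2Liu, prover K2Liu-p09 (g0).  THEOREMS ONLY; lane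
`--supports stmt-HodgeConjecture-24832` (count-neutral helper: hypothesis `hCN` of ★ `godement_parabolic_integral` for `P_Δ(𝔸)`, PLAN v3 §B2,
socket #9 `sig_K2LiuSiegelEisensteinDoubledSummable`).

**`exists_compact_unipotent_cover`**: for the unipotent chart `υ = n ∘ π` (★ `exists_unipotentChart`, taken as HYPOTHESES through its
characterisation) there is a compact `C_N ⊆ N_Δ(𝔸)` with `∀ u ∈ N_Δ(𝔸) ∃ γ ∈ N_Δ(𝔸) ∩ H(L⁺), γ⁻¹ u ∈ C_N`.  PROOF (Tate's `𝔸_L = L + D` entrywise,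
★ `existsUnique_add_algebraMap_mem_adeleFundamentalDomain`, no trace-zero bookkeeping thanks to the projection `π`): write the skew coordinate
`B = blkB (blk u)` as `Q + E` with `Q ∈ M_n(L)` and `E ∈ M_n(D̄)`; `π Q` is skew AND rational, so `γ := υ Q = n(π Q) ∈ H(L⁺)` (★
`mem_ratH_of_blk_eq_unip_map`, `π` commutes with `L → 𝔸_L`), and `γ⁻¹ u = υ(Q)⁻¹ υ(Q + E) = υ E ∈ υ(M_n(D̄)) =: C_N`, compact (Tychonoff,
★ `isCompact_closure_adeleFundamentalDomain`, continuity of `υ`).  [Garrett (2018) §1.5, §3.10: `N_ℚ\N_𝔸` compact; Tate (1967) 4.1.]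

HONEST LABEL.  Count-neutral helper of the K2_Liu road; it retires nothing by itself: `HC_CM` is proved only modulo the 7 printed
citations (2 remaining named inputs: hLiu418 = `stmt-HodgeConjecture-24832`, h413 = `stmt-HodgeConjecture-24833`) until rung 0 closes.

## References
* [Garrett2018] P. Garrett, *Modern Analysis of Automorphic Forms by Example* (2018), §1.5, §3.10.
* [TateThesis1967] J. Tate, *Fourier analysis in number fields and Hecke's zeta-functions*, §4.1 (Thm. 4.1.3, Cor. 4.1.1).
-/

set_option autoImplicit false
-- the mandated namespace repeats the single-problem summit's segment (`HodgeConjecture.HodgeConjecture`)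
set_option linter.dupNamespace false

noncomputable section

open scoped Matrix
open NumberField IsDedekindDomain

namespace Summit.HodgeConjecture.HodgeConjecture.Cruxes.HLiu418.K2LiuSiegelDoubledUnipotentCover

open Literature.NumberTheory.GelbartRogawski1991.AdaptedBlocks
open Literature.NumberTheory.Automorphic Literature.NumberTheory.Automorphic.UnitaryGroup
open Literature.NumberTheory.GelbartRogawski1991 Literature.NumberTheory.GelbartRogawski1991.GRConstruction
open Literature.NumberTheory.K2Lit.SiegelDoubled
open UnitaryDualPair
open Summit.HodgeConjecture.HodgeConjecture.Cruxes.HLiu418.K2LiuSiegelDoubledLeviAlgebra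
open Summit.HodgeConjecture.HodgeConjecture.Cruxes.HLiu418.K2LiuSiegelDoubledBlkUnitary
open Summit.HodgeConjecture.HodgeConjecture.Cruxes.HLiu418.K2LiuSiegelDoubledLeviMatrix
open Summit.HodgeConjecture.HodgeConjecture.Cruxes.HLiu418.K2LiuSiegelDoubledUnipotentChart
open Summit.HodgeConjecture.HodgeConjecture.Cruxes.HLiu418.K2LiuSiegelDoubledRationalPoints

section Doubled

variable (L : Type) [Field L] [NumberField L] [IsCMField L]
variable {N M n : ℕ} (e : Fin N × Fin M ≃ Fin n)
  (dV : Fin N → L) (hdV : ∀ i, IsCMField.complexConj L (dV i) = dV i)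
  (dW : Fin M → L) (hdW : ∀ i, IsCMField.complexConj L (dW i) = dW i)

/-- **`π` commutes with `L → 𝔸_L`**: `(π_L Y) ⊗ 1 = π_𝔸 (Y ⊗ 1)`. [folklore] -/
theorem map_proj (hdV0 : ∀ i, dV i ≠ 0) (hdW0 : ∀ i, dW i ≠ 0) (Y : Matrix (Fin n) (Fin n) L) :
    (⅟(2 : L) • (Y + -(((gramR L e dV hdV dW hdW).map (algebraMap (Fp L) L))⁻¹ *
        (Y.map ((IsCMField.complexConj L : L ≃ₐ[Fp L] L) : L →+* L))ᵀ * (gramR L e dV hdV dW hdW).map (algebraMap (Fp L) L)))).map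
        (algebraMap L (AdeleRing (𝓞 L) L)) =
      ⅟(2 : AdeleRing (𝓞 L) L) • ((Y.map (algebraMap L (AdeleRing (𝓞 L) L))) +
        -(((gramR L e dV hdV dW hdW).map ((algebraMap L (AdeleRing (𝓞 L) L)).comp (algebraMap (Fp L) L)))⁻¹ *
          ((Y.map (algebraMap L (AdeleRing (𝓞 L) L))).map (conjAdele (Fp L) L (IsCMField.complexConj L)))ᵀ *
          (gramR L e dV hdV dW hdW).map ((algebraMap L (AdeleRing (𝓞 L) L)).comp (algebraMap (Fp L) L)))) := by
  obtain ⟨hT, -, -, hTA⟩ := gramRL_facts L e dV hdV dW hdW hdV0 hdW0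
  have hsm : ∀ (c : L) (X : Matrix (Fin n) (Fin n) L), (c • X).map (algebraMap L (AdeleRing (𝓞 L) L)) =
      algebraMap L (AdeleRing (𝓞 L) L) c • X.map (algebraMap L (AdeleRing (𝓞 L) L)) := fun c X => by
    ext i j; simp
  rw [hsm, algebraMap_invOf_two L, Matrix.map_add _ (map_add _), Matrix.map_neg _ (map_neg _), Matrix.map_mul, Matrix.map_mul,
    map_nonsing_inv_of_isUnit _ hT, hTA, map_cstar (algebraMap L (AdeleRing (𝓞 L) L)) (fun x => algebraMap_conj (Fp L) L _ x)]

/-- **A COMPACT FUNDAMENTAL SET for `N_Δ(L⁺) \ N_Δ(𝔸)`** (`dV, dW ≠ 0`).  For a unipotent chart `υ` of `N_Δ` (★ `exists_unipotentChart`: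
continuous, `blk (υ X) = n(π X)`, multiplicative, `υ (blkB (blk u)) = u`), there is a compact `C_N ⊆ N_Δ` such that every `u ∈ N_Δ` is
`γ c` with `γ ∈ N_Δ ∩ H(L⁺)` and `c ∈ C_N`. [cite: Garrett2018, §3.10] [cite: TateThesis1967, §4.1 Thm. 4.1.3] -/
theorem exists_compact_unipotent_cover (hdV0 : ∀ i, dV i ≠ 0) (hdW0 : ∀ i, dW i ≠ 0)
    {Ng : Subgroup (siegelDelta L e dV hdV dW hdW : Subgroup (HA L e dV hdV dW hdW))}
    (υ : Matrix (Fin n) (Fin n) (AdeleRing (𝓞 L) L) → ↥Ng) (hυc : Continuous υ)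
    (hυblk : ∀ X, blk L e dV hdV dW hdW (((υ X : ↥Ng) : (siegelDelta L e dV hdV dW hdW : Subgroup (HA L e dV hdV dW hdW))) : HA L e dV hdV dW hdW) =
      cayR (AdeleRing (𝓞 L) L) (Fin n) * Matrix.fromBlocks 1
        (⅟(2 : AdeleRing (𝓞 L) L) • (X + -(((gramR L e dV hdV dW hdW).map ((algebraMap L (AdeleRing (𝓞 L) L)).comp (algebraMap (Fp L) L)))⁻¹ *
          (X.map (conjAdele (Fp L) L (IsCMField.complexConj L)))ᵀ *
          (gramR L e dV hdV dW hdW).map ((algebraMap L (AdeleRing (𝓞 L) L)).comp (algebraMap (Fp L) L))))) 0 1 *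
        cayRinv (AdeleRing (𝓞 L) L) (Fin n))
    (hυadd : ∀ X X', υ (X + X') = υ X * υ X')
    (hυB : ∀ u : ↥Ng, υ (blkB (blk L e dV hdV dW hdW ((u : (siegelDelta L e dV hdV dW hdW : Subgroup (HA L e dV hdV dW hdW))) :
      HA L e dV hdV dW hdW))) = u) :
    ∃ CN : Set ↥Ng, IsCompact CN ∧ ∀ u : ↥Ng, ∃ γ : ↥Ng,
      ((γ : (siegelDelta L e dV hdV dW hdW : Subgroup (HA L e dV hdV dW hdW))) : HA L e dV hdV dW hdW) ∈ ratH L e dV hdV dW hdW ∧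
        γ⁻¹ * u ∈ CN := by
  classical
  obtain ⟨hT, hTσ, hTt, -⟩ := gramRL_facts L e dV hdV dW hdW hdV0 hdW0
  have hσL : ∀ x, ((IsCMField.complexConj L : L ≃ₐ[Fp L] L) : L →+* L) (((IsCMField.complexConj L : L ≃ₐ[Fp L] L) : L →+* L) x) = x :=
    fun x => IsCMField.complexConj_apply_apply L x
  -- the box `M_n(D̄)` and its image
  set D : Set (AdeleRing (𝓞 L) L) := closure (adeleFundamentalDomain L) with hD
  have hDc : IsCompact D := isCompact_closure_adeleFundamentalDomain L
  set Box : Set (Matrix (Fin n) (Fin n) (AdeleRing (𝓞 L) L)) := {E | ∀ i j, E i j ∈ D} with hBox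
  have hBoxc : IsCompact Box := by
    have h : Box = Set.pi Set.univ (fun _ : Fin n => Set.pi Set.univ (fun _ : Fin n => D)) := by
      ext E
      exact ⟨fun h => Set.mem_univ_pi.2 fun i => Set.mem_univ_pi.2 fun j => h i j,
        fun h i j => Set.mem_univ_pi.1 (Set.mem_univ_pi.1 h i) j⟩
    rw [h]
    exact isCompact_univ_pi fun _ => isCompact_univ_pi fun _ => hDc
  refine ⟨υ '' Box, hBoxc.image hυc, fun u => ?_⟩
  -- decompose the skew coordinate `B = Q + E`
  set B : Matrix (Fin n) (Fin n) (AdeleRing (𝓞 L) L) :=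
    blkB (blk L e dV hdV dW hdW ((u : (siegelDelta L e dV hdV dW hdW : Subgroup (HA L e dV hdV dW hdW))) : HA L e dV hdV dW hdW)) with hB
  choose ξ hξ using fun x : AdeleRing (𝓞 L) L => (existsUnique_add_algebraMap_mem_adeleFundamentalDomain L x).exists
  set q : Matrix (Fin n) (Fin n) L := fun i j => -ξ (B i j) with hq
  set Q : Matrix (Fin n) (Fin n) (AdeleRing (𝓞 L) L) := q.map (algebraMap L (AdeleRing (𝓞 L) L)) with hQ
  set E : Matrix (Fin n) (Fin n) (AdeleRing (𝓞 L) L) := B - Q with hE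
  have hEBox : E ∈ Box := by
    intro i j
    refine subset_closure ?_
    have h := hξ (B i j)
    rw [hE, hQ, Matrix.sub_apply, Matrix.map_apply, hq]
    dsimp only
    rwa [map_neg, sub_neg_eq_add, add_comm]
  have hBQE : B = Q + E := by rw [hE, add_sub_cancel]
  -- the rational element `γ = υ Q`
  refine ⟨υ Q, ?_, ?_⟩
  · refine mem_ratH_of_blk_eq_unip_map L e dV hdV dW hdW (Y := ⅟(2 : L) • (q + -(((gramR L e dV hdV dW hdW).map (algebraMap (Fp L) L))⁻¹ *
        (q.map ((IsCMField.complexConj L : L ≃ₐ[Fp L] L) : L →+* L))ᵀ * (gramR L e dV hdV dW hdW).map (algebraMap (Fp L) L))))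
      (skew_proj hT hTσ hTt hσL q) ?_
    rw [hυblk, map_proj L e dV hdV dW hdW hdV0 hdW0]
  · rw [← hυB u, ← hB, hBQE, hυadd, inv_mul_cancel_left]
    exact Set.mem_image_of_mem _ hEBox

end Doubled

end Summit.HodgeConjecture.HodgeConjecture.Cruxes.HLiu418.K2LiuSiegelDoubledUnipotentCover

end
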